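/-
Copyright: the b2b-balaban cell (near-miss cell 7), T⁴-continuum CRUX team (coordinator ruling e34b3e0c item (2)),
seat t4-ne7b-formalise-leaf-01 (gen 28). Released under the licence of the surrounding project.
-/
import Literature.MathematicalPhysics.QuantumFieldTheory.Balaban1983to89.B7Prop1Explicit

/-!
# (NAS) the lattice non-abelian Stokes INEQUALITY, part 1: lassos, gluing, ladders and the coordinate rectangle
# (route NE7b R-H ∕ C-RH°, `t4/ROUTES-NE7b.md` v7 §1 «A-v6-1 ANSWERED», §6 «[NEW-elementary, K-typable], OFFERED not typed»)

Cell `pub-balaban`, sub-cell `t4`, spine estimate NE7b (node U5c), candidate route R-H «Peierls healing map». ROUTES-NE7b v7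
(seat `t4-ne7b-idea-1` gen 7) decides the cross-check A-v6-1 with three facts, the first of which is elementary lattice gauge
algebra on ONE configuration:

**(NAS)** *«for any configuration, any disc `D` of plaquettes with boundary loop `∂D`, and the bi-invariant size `|W − 1|`:
`|hol(∂D) − 1| ≤ Σ_{p∈D} |U_p − 1|`. Proof: adding one plaquette `p` to a disc along a shared boundary arc replaces the boundary
word `αβ` by `ασβ` with `σ` a based copy of `∂p` (backtracks cancel in `hol`), and `|hol(α)(hol(σ) − 1)hol(β)| = |U_p − 1|` by
bi-invariance; induct on `#D»*.

WHAT THE TREE ALREADY HAS (search-before-claim). The non-abelian Stokes LADDER ∕ RECTANGLE estimate with a UNIFORM plaquette bound: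
`B7Prop1Explicit.ladder_bound` (normed units, `|V(ladder Q) − 1| ≤ |Q|·α`), `B15ShellGauge193.dist1_ladder_seg_le` ∕ `dist1_thick_le`
∕ `thick_succ` (`GaugeGroup.dist1`, `K·n·ε` under `ShellPlaqSmall`), `VillainAngleForm.rectangle_eq_prod_plaquette` (the `U(1)`
identity); the «axial gauge on a spanning tree + (NAS)» step of v7's (1′) is `B7Prop1Explicit.axial_bond_bound` ∕
`B15ShellGauge193.dist1_shellAct_le`.

WHAT THIS FILE ADDS (all PROVED; `GaugeGroup.dist1` of `Balaban1983to89.Setup`, lattice words of `B7Prop1Explicit`):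
* §1 the abstract core at group level — `dist1` of a product is at most the sum (`dist1_list_prod_le`) and **the inequality half
  of (NAS) for ANY loop whose holonomy is exhibited as a product of lassos `gᵢ pᵢ gᵢ⁻¹`** (`dist1_lassoProd_le`; the lattice
  non-abelian Stokes THEOREM supplies such a writing for every disc);
* §2 the DISC-INDUCTION TOOLKIT on words (any group) — backtrack cancellation `hol_backtrack`, insertion of a closed loop
  `hol_glue`, the lasso `hol_lasso`; the boundary word `rectWord κ μ n K` of the `n × K` coordinate rectangle, its holonomy as
  four straight transports (`hol_rectWord`) and the stack-of-ladders recursion `hol_rectWord_succ`;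
* §3 sizes (any `GaugeGroup`) — lasso invariance `dist1_hol_lasso`, concatenation `dist1_hol_append_le`, v7's induction step as
  **THE GLUING LEMMA** `dist1_hol_glue_le : disp σ = 0 → dist1 V(ασβ) ≤ dist1 V(σ) + dist1 V(αβ)`; then the PER-PLAQUETTE SUM forms
  (no uniform `ε`): the ladder over any word (`dist1_hol_ladder_le_sum`), the straight ladder (`dist1_hol_ladder_seg_le_sum`) and
  **(NAS) for the rectangle**: `dist1 V(∂R_{n,K}) ≤ Σ_{j<K} Σ_{i<n} dist1 V(∂p_{κμ}(x + i e_κ + j e_μ))` (`dist1_hol_rectWord_le_sum`),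
  with the uniform form `≤ K·n·ε` as a corollary (`dist1_hol_rectWord_le_mul`).
Part 2 (`NonAbelianStokesReading`) reads this on `Sweep1`'s `ZdGaugeConfig.rectangle ∕ plaquette`, proves (FF) «forced flux», and
gives the unit-quaternion (`S³`) readings for the PH-k chain.

HONEST FRAMING. Law-free algebra about ONE lattice configuration; no measure, no effective action, no constant of
[Bałaban 1983–89] asserted or cited; nothing of bill A∕B's arithmetic or of (MP<L²); (TC)∕(TC-box) and the witness W-hol are NOT
treated. NE7b (`T4WeightBudget.RelWeightBound`) NOT PRINTED, NOT PROVED; spine PROVED 0∕9; rung (B)+1 on a FINITE torus T⁴ —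
NOT infinite volume, NOT the mass gap, NOT Clay. HONEST DEPENDENCY: continuum YM on T⁴ ⇐ BetaPertH ∧ nine spine estimates (0/9
proved); BetaPertH ⇐ (D1) ∧ (D4) ∧ CAP+tail; G-an2-4 gates asym, D1 and NE2/3/4. POLICY: crux-route work under `Spine/NE7b/`
(ROUTES v7 §6's named item, offered to whichever NE7b prover is seated; coordinator FREEZE (0) respected: not a
`T4Continuum/Support` leaf); two concrete list-valued definitions (`ladderLoops`, `rectWord`), no `Prop`-valued fact, no `[cite:]`.
-/

set_option autoImplicit false

namespace Summit.QuantumFields.BalabanUV.T4Continuum.NE7b.NonAbelianStokesBound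

noncomputable section

open Literature.MathematicalPhysics.QuantumFieldTheory.Balaban1983to89 (GaugeGroup dist1)
open Literature.MathematicalPhysics.QuantumFieldTheory.Balaban1983to89.B7Prop1Explicit
  (Letter e disp disp_cons disp_append disp_revWord disp_seg revWord stepHol stepHol_true stepHol_false stepHol_rev hol
   hol_nil hol_cons hol_append hol_revWord hol_revWord' seg seg_natCast hol_seg_succ plaqWord lplaqWord lplaqWord_true ladder
   hol_ladder hol_ladder_cons)

/-! ## §1 The abstract core: `dist1` of products and of products of lassos -/

section GroupLevel

variable {G : Type*} [GaugeGroup G]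

/-- `dist1` of a list product is at most the sum of the `dist1`'s (subadditivity `GaugeGroup.dist1_mul_le`, `dist1 1 = 0`). -/
theorem dist1_list_prod_le : ∀ l : List G, dist1 l.prod ≤ (l.map dist1).sum
  | [] => by simp [GaugeGroup.dist1_one]
  | g :: l => by
    rw [List.prod_cons, List.map_cons, List.sum_cons]
    exact (GaugeGroup.dist1_mul_le _ _).trans (add_le_add le_rfl (dist1_list_prod_le l))

/-- **(NAS), ABSTRACT FORM.** If the holonomy of a loop is written as a product of LASSOS `gᵢ · pᵢ · gᵢ⁻¹` (a based copy of
each plaquette `pᵢ` of a disc), then its size is at most the sum of the plaquette sizes: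
`dist1 (∏ᵢ gᵢ pᵢ gᵢ⁻¹) ≤ Σᵢ dist1 pᵢ` (bi-invariance + subadditivity; no commutativity). -/
theorem dist1_lassoProd_le (l : List (G × G)) :
    dist1 (l.map fun c => c.1 * c.2 * c.1⁻¹).prod ≤ (l.map fun c => dist1 c.2).sum := by
  have h := dist1_list_prod_le (l.map fun c => c.1 * c.2 * c.1⁻¹)
  simpa only [List.map_map, Function.comp_def, GaugeGroup.dist1_conj] using h

end GroupLevel

/-! ## §2 Lattice words in any group: backtracks, gluing, lassos; the rectangle word -/

section Words

variable {d : ℕ} {G : Type*}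

section AnyGroup

variable [Group G] (V : (Fin d → ℤ) → Fin d → G)

/-- **BACKTRACKS CANCEL**: inserting a letter followed by its reverse does not change the holonomy,
`V(α · l · l⁻¹ · β) = V(α · β)`. -/
theorem hol_backtrack (x : Fin d → ℤ) (α β : List (Letter d)) (l : Letter d) :
    hol V x (α ++ l :: l.rev :: β) = hol V x (α ++ β) := by
  rw [hol_append, hol_append, hol_cons, hol_cons, stepHol_rev, Letter.vec_rev, add_neg_cancel_right,
    mul_inv_cancel_left]

/-- **INSERTING A CLOSED LOOP** `σ` (`disp σ = 0`) between `α` and `β`: `V(ασβ) = [V(α) V(σ) V(α)⁻¹] · V(αβ)` — the lasso of `σ`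
along `α` times the old holonomy. -/
theorem hol_glue (x : Fin d → ℤ) (α σ β : List (Letter d)) (hσ : disp σ = 0) :
    hol V x (α ++ σ ++ β) = hol V x α * hol V (x + disp α) σ * (hol V x α)⁻¹ * hol V x (α ++ β) := by
  rw [hol_append, hol_append, hol_append, disp_append, hσ, add_zero]
  group

/-- The LASSO word `α · σ · α⁻¹` has holonomy `V(α) V(σ) V(α)⁻¹` when `σ` is closed. -/
theorem hol_lasso (x : Fin d → ℤ) (α σ : List (Letter d)) (hσ : disp σ = 0) :
    hol V x (α ++ σ ++ revWord α) = hol V x α * hol V (x + disp α) σ * (hol V x α)⁻¹ := by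
  rw [hol_append, hol_append, disp_append, hσ, add_zero, hol_revWord]

/-- The elementary loops met along the ladder of the word `w` in direction `μ`: at each letter `l` of `w`, read at the running
position, the holonomy of the loop `lplaqWord l μ` (a plaquette for a forward letter, a conjugated inverse plaquette for a
backward one). -/
def ladderLoops : (Fin d → ℤ) → List (Letter d) → Fin d → List G
  | _, [], _ => []
  | x, l :: w, μ => hol V x (lplaqWord l μ) :: ladderLoops (x + l.vec) w μ

/-- `ladderLoops` of the empty word. -/
@[simp] theorem ladderLoops_nil (x : Fin d → ℤ) (μ : Fin d) : ladderLoops V x [] μ = [] := rfl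

/-- `ladderLoops` of a cons. -/
@[simp] theorem ladderLoops_cons (x : Fin d → ℤ) (l : Letter d) (w : List (Letter d)) (μ : Fin d) :
    ladderLoops V x (l :: w) μ = hol V x (lplaqWord l μ) :: ladderLoops V (x + l.vec) w μ := rfl

/-- One elementary loop per letter. -/
@[simp] theorem length_ladderLoops : ∀ (x : Fin d → ℤ) (w : List (Letter d)) (μ : Fin d),
    (ladderLoops V x w μ).length = w.length
  | _, [], _ => rfl
  | x, l :: w, μ => by rw [ladderLoops_cons, List.length_cons, List.length_cons, length_ladderLoops]

/-- **THE BOUNDARY WORD OF THE `n × K` COORDINATE RECTANGLE** based at `x` in the `(κ, μ)`-plane: `n` steps `+e_κ`, `K` steps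
`+e_μ`, `n` steps `−e_κ`, `K` steps `−e_μ` (the rectangular Wilson loop `γ_{n,K}`; for `n = K = 1` it is `plaqWord κ μ`). -/
def rectWord (κ μ : Fin d) (n K : ℕ) : List (Letter d) :=
  seg κ n ++ seg μ K ++ revWord (seg κ n) ++ revWord (seg μ K)

/-- The rectangle word is closed. -/
@[simp] theorem disp_rectWord (κ μ : Fin d) (n K : ℕ) : disp (rectWord κ μ n K : List (Letter d)) = 0 := by
  simp [rectWord]

/-- The `1 × 1` rectangle word is the plaquette word. -/
theorem rectWord_one_one (κ μ : Fin d) : (rectWord κ μ 1 1 : List (Letter d)) = plaqWord κ μ := rfl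

/-- The backward straight segment read from its END point: `V(−[y − n e_κ, y]) = V([y − n e_κ, y])⁻¹`. -/
theorem hol_revWord_seg (y : Fin d → ℤ) (κ : Fin d) (n : ℕ) :
    hol V y (revWord (seg κ n)) = (hol V (y - (n : ℤ) • e κ) (seg κ n))⁻¹ :=
  hol_revWord' V _ _ (by rw [disp_seg, sub_add_cancel])

/-- **THE RECTANGLE HOLONOMY** as four straight transports: `V(∂R) = V([x, x+ne_κ])·V([x+ne_κ, x+ne_κ+Ke_μ])·V([x+Ke_μ,
x+Ke_μ+ne_κ])⁻¹·V([x, x+Ke_μ])⁻¹` (this is `B15ShellGauge193.thick V x (seg κ n) μ K`, stated here without that import). -/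
theorem hol_rectWord (x : Fin d → ℤ) (κ μ : Fin d) (n K : ℕ) :
    hol V x (rectWord κ μ n K) = hol V x (seg κ n) * hol V (x + (n : ℤ) • e κ) (seg μ K) *
      (hol V (x + (K : ℤ) • e μ) (seg κ n))⁻¹ * (hol V x (seg μ K))⁻¹ := by
  rw [rectWord]
  simp only [hol_append, disp_append, disp_seg, disp_revWord, hol_revWord_seg]
  have h3 : x + ((n : ℤ) • e κ + (K : ℤ) • e μ) - (n : ℤ) • e κ = x + (K : ℤ) • e μ := by abel
  have h4 : x + ((n : ℤ) • e κ + (K : ℤ) • e μ + -((n : ℤ) • e κ)) - (K : ℤ) • e μ = x := by abel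
  rw [h3, h4]

/-- **THE RECTANGLE RECURSION** (a rectangle is a stack of ladders): raising the height by one multiplies `V(∂R_{n,K})` on the
right by the ladder of `[x, x + ne_κ]` at height `K`, conjugated by the transport `V([x, x + Ke_μ])` (cf. `B15ShellGauge193.thick_succ`). -/
theorem hol_rectWord_succ (x : Fin d → ℤ) (κ μ : Fin d) (n K : ℕ) :
    hol V x (rectWord κ μ n (K + 1)) = hol V x (rectWord κ μ n K) *
      (hol V x (seg μ K) * hol V (x + (K : ℤ) • e μ) (ladder (seg κ n) μ) * (hol V x (seg μ K))⁻¹) := by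
  rw [hol_rectWord, hol_rectWord, hol_ladder, disp_seg]
  have h1 : ((K + 1 : ℕ) : ℤ) = (K : ℤ) + 1 := by push_cast; ring
  rw [h1, hol_seg_succ, hol_seg_succ, add_smul, one_smul,
    show x + (n : ℤ) • e κ + (K : ℤ) • e μ = x + (K : ℤ) • e μ + (n : ℤ) • e κ by abel,
    show x + ((K : ℤ) • e μ + e μ) = x + (K : ℤ) • e μ + e μ by abel]
  group

/-- The height-`0` rectangle is degenerate: holonomy `1`. -/
theorem hol_rectWord_zero (x : Fin d → ℤ) (κ μ : Fin d) (n : ℕ) : hol V x (rectWord κ μ n 0) = 1 := by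
  rw [hol_rectWord]
  simp

end AnyGroup

/-! ## §3 Sizes in a `GaugeGroup`: the gluing lemma and the per-plaquette sums -/

variable [GaugeGroup G] (V : (Fin d → ℤ) → Fin d → G)

/-- **LASSO INVARIANCE**: `dist1 V(α σ α⁻¹) = dist1 V(σ)` for a closed `σ` (bi-invariance of `dist1`). -/
theorem dist1_hol_lasso (x : Fin d → ℤ) (α σ : List (Letter d)) (hσ : disp σ = 0) :
    dist1 (hol V x (α ++ σ ++ revWord α)) = dist1 (hol V (x + disp α) σ) := by
  rw [hol_lasso V x α σ hσ, GaugeGroup.dist1_conj]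

/-- **CONCATENATION**: `dist1 V(w₁ w₂) ≤ dist1 V(w₁) + dist1 V(w₂)`. -/
theorem dist1_hol_append_le (x : Fin d → ℤ) (w₁ w₂ : List (Letter d)) :
    dist1 (hol V x (w₁ ++ w₂)) ≤ dist1 (hol V x w₁) + dist1 (hol V (x + disp w₁) w₂) := by
  rw [hol_append]
  exact GaugeGroup.dist1_mul_le _ _

/-- **THE GLUING LEMMA (v7's induction step of (NAS))**: inserting a closed loop `σ` into a boundary word `αβ` at the end of
`α` costs at most `dist1 V(σ)`: `dist1 V(ασβ) ≤ dist1 V(σ) + dist1 V(αβ)`. With `hol_backtrack` (backtracks cancel) this is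
the step «disc `D` ↦ disc `D ∪ {p}` along a shared boundary arc»; iterating from the empty word gives (NAS) for every disc whose
boundary word is so generated. -/
theorem dist1_hol_glue_le (x : Fin d → ℤ) (α σ β : List (Letter d)) (hσ : disp σ = 0) :
    dist1 (hol V x (α ++ σ ++ β)) ≤ dist1 (hol V (x + disp α) σ) + dist1 (hol V x (α ++ β)) := by
  rw [hol_glue V x α σ β hσ]
  calc dist1 (hol V x α * hol V (x + disp α) σ * (hol V x α)⁻¹ * hol V x (α ++ β))
      ≤ dist1 (hol V x α * hol V (x + disp α) σ * (hol V x α)⁻¹) + dist1 (hol V x (α ++ β)) :=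
        GaugeGroup.dist1_mul_le _ _
    _ = dist1 (hol V (x + disp α) σ) + dist1 (hol V x (α ++ β)) := by rw [GaugeGroup.dist1_conj]

/-- The elementary loop of a BACKWARD letter `−e_κ` closed by `+e_μ` is the inverse plaquette at `x − e_κ` conjugated by a bond
variable; hence it has the size of that plaquette: `dist1 V(lplaqWord (κ,false) μ; x) = dist1 V(∂p_{κμ}(x − e_κ))`. -/
theorem dist1_hol_lplaqWord_false (x : Fin d → ℤ) (κ μ : Fin d) :
    dist1 (hol V x (lplaqWord (κ, false) μ)) = dist1 (hol V (x - e κ) (plaqWord κ μ)) := by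
  have hid : hol V x (lplaqWord (κ, false) μ) =
      (V (x - e κ) κ)⁻¹ * (hol V (x - e κ) (plaqWord κ μ))⁻¹ * ((V (x - e κ) κ)⁻¹)⁻¹ := by
    simp only [lplaqWord, plaqWord, hol_cons, hol_nil, mul_one, stepHol_true, stepHol_false, Letter.rev_mk,
      Bool.not_false, Letter.vec_true, Letter.vec_false, mul_inv_rev, inv_inv]
    abel_nf
    group
  rw [hid, GaugeGroup.dist1_conj, GaugeGroup.dist1_inv]

/-- The elementary loop of a FORWARD letter is the plaquette itself: `lplaqWord (κ,true) μ = plaqWord κ μ`. -/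
theorem dist1_hol_lplaqWord_true (x : Fin d → ℤ) (κ μ : Fin d) :
    dist1 (hol V x (lplaqWord (κ, true) μ)) = dist1 (hol V x (plaqWord κ μ)) := by
  rw [lplaqWord_true]

/-- **(NAS) FOR LADDERS, PER PLAQUETTE**: the ladder loop over ANY word `w` (out along `w`, one step `+e_μ`, back along the
shifted `w`, one step `−e_μ`) has `dist1 ≤ Σ_{letters of w} dist1 (elementary loop)` — the tree's `B7Prop1Explicit.ladder_bound` ∕
`B15ShellGauge193.dist1_ladder_seg_le` without the uniform bound (recursion `hol_ladder_cons`). -/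
theorem dist1_hol_ladder_le_sum : ∀ (x : Fin d → ℤ) (w : List (Letter d)) (μ : Fin d),
    dist1 (hol V x (ladder w μ)) ≤ ((ladderLoops V x w μ).map dist1).sum
  | x, [], μ => by
    rw [hol_ladder]
    simp [GaugeGroup.dist1_one]
  | x, l :: w, μ => by
    rw [hol_ladder_cons, ladderLoops_cons, List.map_cons, List.sum_cons]
    have ih := dist1_hol_ladder_le_sum (x + l.vec) w μ
    calc dist1 (stepHol V x l * hol V (x + l.vec) (ladder w μ) * (stepHol V x l)⁻¹ * hol V x (lplaqWord l μ))
        ≤ dist1 (stepHol V x l * hol V (x + l.vec) (ladder w μ) * (stepHol V x l)⁻¹) + dist1 (hol V x (lplaqWord l μ)) :=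
          GaugeGroup.dist1_mul_le _ _
      _ = dist1 (hol V (x + l.vec) (ladder w μ)) + dist1 (hol V x (lplaqWord l μ)) := by rw [GaugeGroup.dist1_conj]
      _ ≤ ((ladderLoops V (x + l.vec) w μ).map dist1).sum + dist1 (hol V x (lplaqWord l μ)) := add_le_add ih le_rfl
      _ = dist1 (hol V x (lplaqWord l μ)) + ((ladderLoops V (x + l.vec) w μ).map dist1).sum := add_comm _ _

/-- **THE STRAIGHT LADDER** (the `n × 1` rectangle in the `(κ, μ)`-plane based at `x`):
`dist1 ≤ Σ_{i<n} dist1 V(∂p_{κμ}(x + i e_κ))`. -/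
theorem dist1_hol_ladder_seg_le_sum (κ μ : Fin d) :
    ∀ (n : ℕ) (x : Fin d → ℤ), dist1 (hol V x (ladder (seg κ n) μ)) ≤
      ∑ i ∈ Finset.range n, dist1 (hol V (x + (i : ℤ) • e κ) (plaqWord κ μ))
  | 0, x => by
    rw [seg_natCast, List.replicate_zero, hol_ladder]
    simp [GaugeGroup.dist1_one]
  | n + 1, x => by
    rw [seg_natCast, List.replicate_succ, ← seg_natCast, hol_ladder_cons, lplaqWord_true, Letter.vec_true,
      Finset.sum_range_succ' _ n]
    have ih := dist1_hol_ladder_seg_le_sum κ μ n (x + e κ)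
    have hsh : ∀ i : ℕ, x + e κ + (i : ℤ) • e κ = x + ((i + 1 : ℕ) : ℤ) • e κ := fun i => by
      rw [Nat.cast_succ, add_smul, one_smul]; abel
    simp only [Nat.cast_zero, zero_smul, add_zero]
    calc dist1 (stepHol V x (κ, true) * hol V (x + e κ) (ladder (seg κ ↑n) μ) * (stepHol V x (κ, true))⁻¹ *
            hol V x (plaqWord κ μ))
        ≤ dist1 (stepHol V x (κ, true) * hol V (x + e κ) (ladder (seg κ ↑n) μ) * (stepHol V x (κ, true))⁻¹) +
            dist1 (hol V x (plaqWord κ μ)) := GaugeGroup.dist1_mul_le _ _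
      _ = dist1 (hol V (x + e κ) (ladder (seg κ ↑n) μ)) + dist1 (hol V x (plaqWord κ μ)) := by
          rw [GaugeGroup.dist1_conj]
      _ ≤ (∑ i ∈ Finset.range n, dist1 (hol V (x + ((i + 1 : ℕ) : ℤ) • e κ) (plaqWord κ μ))) +
            dist1 (hol V x (plaqWord κ μ)) := by
          refine add_le_add (ih.trans (le_of_eq (Finset.sum_congr rfl fun i _ => ?_))) le_rfl
          rw [hsh]

/-- **(NAS) FOR THE COORDINATE RECTANGLE, PER PLAQUETTE**: the `n × K` rectangular Wilson loop based at `x` in the `(κ, μ)`-plane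
satisfies `dist1 V(∂R) ≤ Σ_{j<K} Σ_{i<n} dist1 V(∂p_{κμ}(x + i e_κ + j e_μ))` — the sum of the sizes of its `nK` plaquettes, each
entering once (ROUTES-NE7b v7 §1 (NAS) for rectangular discs; no uniform bound, no commutativity, any `GaugeGroup`). -/
theorem dist1_hol_rectWord_le_sum (x : Fin d → ℤ) (κ μ : Fin d) (n : ℕ) :
    ∀ K : ℕ, dist1 (hol V x (rectWord κ μ n K)) ≤
      ∑ j ∈ Finset.range K, ∑ i ∈ Finset.range n, dist1 (hol V (x + (i : ℤ) • e κ + (j : ℤ) • e μ) (plaqWord κ μ))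
  | 0 => by rw [hol_rectWord_zero, GaugeGroup.dist1_one]; simp
  | K + 1 => by
    rw [hol_rectWord_succ, Finset.sum_range_succ]
    have ih := dist1_hol_rectWord_le_sum x κ μ n K
    have hlad := dist1_hol_ladder_seg_le_sum V κ μ n (x + (K : ℤ) • e μ)
    calc dist1 (hol V x (rectWord κ μ n K) *
            (hol V x (seg μ ↑K) * hol V (x + (K : ℤ) • e μ) (ladder (seg κ ↑n) μ) * (hol V x (seg μ ↑K))⁻¹))
        ≤ dist1 (hol V x (rectWord κ μ n K)) +
            dist1 (hol V x (seg μ ↑K) * hol V (x + (K : ℤ) • e μ) (ladder (seg κ ↑n) μ) * (hol V x (seg μ ↑K))⁻¹) :=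
          GaugeGroup.dist1_mul_le _ _
      _ = dist1 (hol V x (rectWord κ μ n K)) + dist1 (hol V (x + (K : ℤ) • e μ) (ladder (seg κ ↑n) μ)) := by
          rw [GaugeGroup.dist1_conj]
      _ ≤ _ := add_le_add ih (hlad.trans (le_of_eq (Finset.sum_congr rfl fun i _ => by
          rw [show x + (K : ℤ) • e μ + (i : ℤ) • e κ = x + (i : ℤ) • e κ + (K : ℤ) • e μ by abel])))

/-- The same with a UNIFORM bound recovered as a corollary: if every plaquette of the rectangle has `dist1 ≤ ε` then
`dist1 V(∂R) ≤ K·n·ε` (the form landed in `B15ShellGauge193.dist1_thick_seg_le`, here without the frozen-coordinate context). -/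
theorem dist1_hol_rectWord_le_mul (x : Fin d → ℤ) (κ μ : Fin d) (n K : ℕ) {ε : ℝ}
    (h : ∀ i j : ℕ, i < n → j < K → dist1 (hol V (x + (i : ℤ) • e κ + (j : ℤ) • e μ) (plaqWord κ μ)) ≤ ε) :
    dist1 (hol V x (rectWord κ μ n K)) ≤ K * (n * ε) := by
  refine (dist1_hol_rectWord_le_sum V x κ μ n K).trans ?_
  calc ∑ j ∈ Finset.range K, ∑ i ∈ Finset.range n, dist1 (hol V (x + (i : ℤ) • e κ + (j : ℤ) • e μ) (plaqWord κ μ))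
      ≤ ∑ j ∈ Finset.range K, ∑ i ∈ Finset.range n, ε :=
        Finset.sum_le_sum fun j hj => Finset.sum_le_sum fun i hi =>
          h i j (Finset.mem_range.mp hi) (Finset.mem_range.mp hj)
    _ = K * (n * ε) := by simp

end Words

/-! ## (v1.1) IF2-31 bridge: the Literature spelling of the rectangle word (append-only; nothing above is changed) -/

section LitBridge

variable {d : ℕ}

/-- **IF2-31 BRIDGE** (lit-balaban `INTERFACES.md` §2 row IF2-31, Q-IF2-10 answered `AGREE-BRIDGE`): this file's `rectWord κ μ n K` IS the
substrate's Literature word `B7Prop1Explicit.rectWord n K κ μ` (the rectangular contour of [Balaban1985Averaging] (48) as typed there) up to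
argument order and the `revWord ∘ seg` spelling of the two return sides — equal by `revWord_seg`, not `rfl`. Non-breaking: every name of this
file is kept; consumers transport `hol_rectWord` ∕ `dist1_hol_rectWord_le_sum` to the Literature word by `rw [rectWord_eq_lit]`. -/
theorem rectWord_eq_lit (κ μ : Fin d) (n K : ℕ) :
    (rectWord κ μ n K : List (Letter d)) =
      Literature.MathematicalPhysics.QuantumFieldTheory.Balaban1983to89.B7Prop1Explicit.rectWord n K κ μ := by
  rw [rectWord, Literature.MathematicalPhysics.QuantumFieldTheory.Balaban1983to89.B7Prop1Explicit.rectWord,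
    Literature.MathematicalPhysics.QuantumFieldTheory.Balaban1983to89.B7Prop1Explicit.revWord_seg,
    Literature.MathematicalPhysics.QuantumFieldTheory.Balaban1983to89.B7Prop1Explicit.revWord_seg]

end LitBridge

end

end Summit.QuantumFields.BalabanUV.T4Continuum.NE7b.NonAbelianStokesBound
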